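import Literature.NumberTheory.Automorphic.PlaneLatticesCompanionSelfDualCount        -- ★ (β2′-ii): strata `q^k`, total `Σ_{k≤N} q^k`; brings (β2′-i), (β1), (L5-a/b), `natCard_antifixed_quotient_pow`
import Literature.NumberTheory.Automorphic.PlaneLatticesCompanionScalarReduction     -- ★ B-p08: `companion_scalarReduction_iff_of_hermite` (the interior-vertex criterion)
import HarnessLib

/-!
# The INTERIOR vertices of the fixed ball of a type-(2) elliptic element: `#{Λ ∈ S(!![0,β;σβ,0], C) | C ≡ (t∕2)·1 (mod ϖ) on Λ} = Σ_{k<N} q^k`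

Topic `NumberTheory/Automorphic`; namespace `Literature.NumberTheory.Automorphic`.  THEOREMS ONLY (no definition, no instance, no notation, no named fact,
no `sorry`).  Cell `pub/hodgecm-mathlib`, (R2) Euler–Poincaré road (Kottwitz's function on the tree of `U(1,1)`), brick (R2-t2)(b) layer (E-β) count (B-p08 (g27)).
With ★ (β2′-ii) (`#S = Σ_{k≤N} q^k`, the fixed `K`-vertices of the ball of radius `N + ½` about an edge midpoint) and ★ `companion_scalarReduction_iff_of_hermite`
(interior iff `1 ≤ 2k + e ∧ k + e ≤ N ∧ ϖ^{−(k+1)}(2y′ + t) ∈ 𝒪`), the interior vertices number `Σ_{k<N} q^k` in BOTH parities `e`: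
for `e = 1` they are the strata `k < N` (★ counts); for `e = 0` the stratum `k ≥ 1` contributes its lattices with parameter `x ∈ 𝔪` — the anti-fixed classes
`x = ϖx₁`, `x₁` mod `𝔪^{k−1}`, `q^{k−1}` of them (§1, the refined (β2′-ii) bijection).  Consequence for Kottwitz's edge count: `E(γ) = (q+1)·Σ_{k<N} q^k + q^N = 2·Σ_{k≤N} q^k − 1`.

* §1 `ncard_stratum_scalarReduction_antidiag_companion_eq_natCard_antifixed` (`e = 0`, `1 ≤ k ≤ N`): refined stratum ↔ anti-fixed classes mod `𝔪^{k−1}`.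
[cite: Flicker1998UnitaryFL, §6 p. 97] [cite: Serre1979, Ch. V §2]
-/

set_option autoImplicit false

noncomputable section

open scoped ValuativeRel Matrix MatrixGroups
open Matrix ValuativeRel Finset IsLocalRing

namespace Literature.NumberTheory.Automorphic

variable {F : Type*} [Field F] [ValuativeRel F] {ϖ : F} (hϖ : IsUniformizingElement ϖ) (σ : F →+* F)
  [IsDiscreteValuationRing 𝒪[F]]
  (σO : 𝒪[F] →+* 𝒪[F]) (hσO' : ∀ x : 𝒪[F], ((σO x : 𝒪[F]) : F) = σ x) (hσσ : ∀ x, σO (σO x) = x)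
  (hσϖ : σ ϖ = ϖ) (hσv : ∀ x, valuation F (σ x) = valuation F x) (h2 : valuation F 2 = 1)
  {t d β : F} (ht : t ∈ 𝒪[F]) (hd : valuation F d = 1) {e : ℕ} (he : e ≤ 1) (hβ : valuation F β = valuation F (ϖ ^ e))
  {N : ℕ} (hD : valuation F (t ^ 2 - 4 * d) = valuation F (ϖ ^ (2 * N + 1))) (htr : β * σ t + σ β * t = 0)
  (γ : GL (Fin 2) F) (hγ : (γ : Matrix (Fin 2) (Fin 2) F) = !![0, -d; 1, t])

/-! ## §1 Parity `e = 0`: the interior lattices of the stratum `k ≥ 1` ↔ anti-fixed classes mod `𝔪^{k−1}` -/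

include hϖ hσO' hσσ hσϖ hσv h2 ht hd he hβ hD htr hγ in
/-- **THE REFINED STRATUM (`e = 0`, `1 ≤ k ≤ N`)**: the self-dual `C`-stable Hermite lattices `Λ(T(k, y, −k))` with `ϖ^{−(k+1)}(2y′ + t) ∈ 𝒪` (the INTERIOR ones, ★
`companion_scalarReduction_iff_of_hermite`) are in bijection with the anti-fixed classes of `𝒪 ⧸ 𝔪^{k−1}` via `x₁ ↦ x = ϖx₁ ↦ y = (u⁻¹x − ϖ^{−k}t)∕2` (the ★ (β2′-ii)
parametrisation restricted to `x ∈ 𝔪`). [cite: Flicker1998UnitaryFL, §6 p. 97] [cite: Serre1979, Ch. V §2] -/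
theorem ncard_stratum_scalarReduction_antidiag_companion_eq_natCard_antifixed (he0 : e = 0) {k : ℕ} (hk1 : 1 ≤ k) (hk : k ≤ N) :
    {Λ : Submodule 𝒪[F] (Fin 2 → F) | ∃ (y : F) (g : GL (Fin 2) F), (g : Matrix (Fin 2) (Fin 2) F) = !![ϖ ^ (k : ℤ), y; 0, ϖ ^ (-(k : ℤ) - e)] ∧
        (∃ J' ∈ glInt 2 F, (J' : Matrix (Fin 2) (Fin 2) F) = formCongr σ g (!![0, β; σ β, 0] : Matrix (Fin 2) (Fin 2) F)) ∧
        (Submodule.span 𝒪[F] (Set.range ((g : Matrix (Fin 2) (Fin 2) F))ᵀ)).map ((Matrix.toLin' (γ : Matrix (Fin 2) (Fin 2) F)).restrictScalars 𝒪[F]) =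
          Submodule.span 𝒪[F] (Set.range ((g : Matrix (Fin 2) (Fin 2) F))ᵀ) ∧
        ϖ ^ (-((k + 1 : ℕ) : ℤ)) * (2 * (ϖ ^ (-(-(k : ℤ) - e)) * y) + t) ∈ 𝒪[F] ∧
        Λ = Submodule.span 𝒪[F] (Set.range ((g : Matrix (Fin 2) (Fin 2) F))ᵀ)}.ncard =
      Nat.card {x : 𝒪[F] ⧸ maximalIdeal 𝒪[F] ^ (k - 1) //
        Ideal.quotientMap (maximalIdeal 𝒪[F] ^ (k - 1)) σO (LocalFields.UnramifiedQuadraticNorm.maximalIdeal_pow_le_comap σO hσσ (k - 1)) x = -x} := by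
  classical
  have h0 := hϖ.ne_zero
  have h20 : (2 : F) ≠ 0 := fun h => by rw [h, map_zero] at h2; exact zero_ne_one h2
  have hσO : ∀ x : 𝒪[F], σ x ∈ 𝒪[F] := fun x => by rw [← hσO' x]; exact (σO x).2
  have hσσF : ∀ x : 𝒪[F], σ (σ (x : F)) = x := fun x => by
    have := congrArg (fun y : 𝒪[F] => (y : F)) (hσσ x); rwa [hσO', hσO'] at this
  have hdetT : ∀ y : F, (!![ϖ ^ (k : ℤ), y; 0, ϖ ^ (-(k : ℤ) - e)] : Matrix (Fin 2) (Fin 2) F).det ≠ 0 := fun y => by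
    rw [Matrix.det_fin_two_of, mul_zero, sub_zero]; exact mul_ne_zero (zpow_ne_zero _ h0) (zpow_ne_zero _ h0)
  -- the unit `u = σ(β₁)`, `β₁ = ϖ^{-e} β ∈ 𝒪^×`
  have hβ1v : valuation F (ϖ ^ (-(e : ℤ)) * β) = 1 := by
    rw [map_mul, hβ, ← map_mul, ← zpow_natCast, ← zpow_add₀ h0, neg_add_cancel, zpow_zero, map_one]
  have hβ1O : ϖ ^ (-(e : ℤ)) * β ∈ 𝒪[F] := (Valuation.mem_integer_iff _ _).2 hβ1v.le
  have hβ0 : β ≠ 0 := fun h => by rw [h, mul_zero, map_zero] at hβ1v; exact zero_ne_one hβ1v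
  have hσβ0 : σ β ≠ 0 := (map_ne_zero σ).2 hβ0
  set u : F := σ (ϖ ^ (-(e : ℤ)) * β) with hu
  have hue : u = ϖ ^ (-(e : ℤ)) * σ β := by rw [hu, map_mul, map_zpow₀, hσϖ]
  have huv : valuation F u = 1 := by rw [hu, hσv]; exact hβ1v
  have hu0 : u ≠ 0 := fun h => by rw [h, map_zero] at huv; exact zero_ne_one huv
  have huO : u ∈ 𝒪[F] := (Valuation.mem_integer_iff _ _).2 huv.le
  have huiO : u⁻¹ ∈ 𝒪[F] := (Valuation.mem_integer_iff _ _).2 (by rw [map_inv₀, huv, inv_one])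
  have hσu : σ u = ϖ ^ (-(e : ℤ)) * β := by rw [hu]; exact hσσF ⟨_, hβ1O⟩
  have hσ2 : σ (2 : F)⁻¹ = 2⁻¹ := by rw [map_inv₀, map_ofNat]
  have h2i : (2 : F)⁻¹ ∈ 𝒪[F] := (Valuation.mem_integer_iff _ _).2 (by rw [map_inv₀, h2, inv_one])
  -- the parametrisation `x ↦ y(x) = (u⁻¹ x − ϖ^{−(k+e)} t) / 2`
  set yOf : F → F := fun x => (u⁻¹ * x - ϖ ^ (-((k + e : ℕ) : ℤ)) * t) * 2⁻¹ with hyOf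
  -- (F1) `y′ = ϖ^{k+e} y` and `ϖ^{-(k+e)}(2y′ + t) = u⁻¹ x`
  have hF1 : ∀ x : F, ϖ ^ (-((k + e : ℕ) : ℤ)) * (2 * (ϖ ^ (-(-(k : ℤ) - e)) * yOf x) + t) = u⁻¹ * x := fun x => by
    rw [hyOf]
    have : (ϖ : F) ^ (-(-(k : ℤ) - e)) = (ϖ ^ (-((k + e : ℕ) : ℤ)))⁻¹ := by rw [← _root_.zpow_neg]; congr 1; push_cast; ring
    rw [this]; field_simp; ring
  have hF1' : ∀ x : F, x ∈ 𝒪[F] → ϖ ^ (-(-(k : ℤ) - e)) * yOf x ∈ 𝒪[F] := fun x hx => by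
    have : ϖ ^ (-(-(k : ℤ) - e)) * yOf x = (ϖ ^ ((k + e : ℕ) : ℤ) * (u⁻¹ * x) - t) * 2⁻¹ := by
      rw [hyOf]
      have e1 : (ϖ : F) ^ (-(-(k : ℤ) - e)) = ϖ ^ ((k + e : ℕ) : ℤ) := by congr 1; push_cast; ring
      have e2 : (ϖ : F) ^ ((k + e : ℕ) : ℤ) * ϖ ^ (-((k + e : ℕ) : ℤ)) = 1 := by rw [← zpow_add₀ h0, add_neg_cancel, zpow_zero]
      rw [e1]
      calc ϖ ^ ((k + e : ℕ) : ℤ) * ((u⁻¹ * x - ϖ ^ (-((k + e : ℕ) : ℤ)) * t) * 2⁻¹)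
          = (ϖ ^ ((k + e : ℕ) : ℤ) * (u⁻¹ * x) - (ϖ ^ ((k + e : ℕ) : ℤ) * ϖ ^ (-((k + e : ℕ) : ℤ))) * t) * 2⁻¹ := by ring
        _ = _ := by rw [e2, one_mul]
    rw [this]
    exact (𝒪[F]).mul_mem ((𝒪[F]).sub_mem ((𝒪[F]).mul_mem ((zpow_uniformizer_mem_integer_iff hϖ _).2 (by positivity))
      ((𝒪[F]).mul_mem huiO hx)) ht) h2i
  -- (F2) the trace expression: `β σy + σβ y = ϖ^e (x + σx) / 2`
  have hF2 : ∀ x : F, β * σ (yOf x) + σ β * yOf x = ϖ ^ (e : ℤ) * (x + σ x) * 2⁻¹ := fun x => by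
    rw [hyOf]
    simp only [map_mul, map_sub, map_inv₀, hσu, map_zpow₀, hσϖ, hσ2]
    rw [hue]
    have hβi : (ϖ ^ (-(e : ℤ)) * β)⁻¹ = ϖ ^ (e : ℤ) * β⁻¹ := by rw [mul_inv, ← _root_.zpow_neg, neg_neg]
    have hσβi : (ϖ ^ (-(e : ℤ)) * σ β)⁻¹ = ϖ ^ (e : ℤ) * (σ β)⁻¹ := by rw [mul_inv, ← _root_.zpow_neg, neg_neg]
    rw [hβi, hσβi]
    have htr' : σ β * t = -(β * σ t) := by linear_combination htr
    field_simp
    linear_combination (- ϖ ^ (-((k + e : ℕ) : ℤ))) * htr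
  -- (F3) for `x ∈ 𝒪`: the lattice `Λ(T(k, y(x), −k−e))` is `C`-stable, and self-dual iff `x̄` is anti-fixed
  have hF3st : ∀ (x : F) (hx : x ∈ 𝒪[F]) (g : GL (Fin 2) F), (g : Matrix (Fin 2) (Fin 2) F) = !![ϖ ^ (k : ℤ), yOf x; 0, ϖ ^ (-(k : ℤ) - e)] →
      (Submodule.span 𝒪[F] (Set.range ((g : Matrix (Fin 2) (Fin 2) F))ᵀ)).map ((Matrix.toLin' (γ : Matrix (Fin 2) (Fin 2) F)).restrictScalars 𝒪[F]) =
        Submodule.span 𝒪[F] (Set.range ((g : Matrix (Fin 2) (Fin 2) F))ᵀ) := fun x hx g hg => by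
    refine (map_companion_span_eq_self_iff_of_hermite hϖ γ g hγ hd ht hg).2 ⟨by omega, hF1' x hx, ?_⟩
    rw [(companion_rescale_identities h0 (k := k) (e := e) rfl (yOf x) t d β (σ β) (σ (yOf x))).1]
    exact (norm_condition_iff hϖ h2 ht hD he (hF1' x hx)).2 ⟨hk, by rw [hF1 x]; exact (𝒪[F]).mul_mem huiO hx⟩
  have hF3sd : ∀ (x : 𝒪[F]) (g : GL (Fin 2) F), (g : Matrix (Fin 2) (Fin 2) F) = !![ϖ ^ (k : ℤ), yOf x; 0, ϖ ^ (-(k : ℤ) - e)] →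
      ((∃ J' ∈ glInt 2 F, (J' : Matrix (Fin 2) (Fin 2) F) = formCongr σ g (!![0, β; σ β, 0] : Matrix (Fin 2) (Fin 2) F)) ↔
        (Ideal.quotientMap (maximalIdeal 𝒪[F] ^ k) σO (LocalFields.UnramifiedQuadraticNorm.maximalIdeal_pow_le_comap σO hσσ k)) (Ideal.Quotient.mk (maximalIdeal 𝒪[F] ^ k) x) = -Ideal.Quotient.mk (maximalIdeal 𝒪[F] ^ k) x) := fun x g hg => by
    rw [exists_mem_glInt_coe_eq_formCongr_hermite_antidiag_iff σ hϖ hσϖ hσv g hg]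
    have hv1 : valuation F (β * ϖ ^ ((k : ℤ) + (-(k : ℤ) - e))) = 1 := by
      rw [show (k : ℤ) + (-(k : ℤ) - e) = -(e : ℤ) by ring, mul_comm]; exact hβ1v
    simp only [hv1, true_and]
    rw [hF2]
    -- `ϖ^{-k-e} (ϖ^e (x + σx) / 2) = ϖ^{-k} (x + σx) · 2⁻¹`
    have e1 : (ϖ : F) ^ (-(k : ℤ) - e) * (ϖ ^ (e : ℤ) * ((x : F) + σ x) * 2⁻¹) = (ϖ ^ (-(k : ℤ)) * (((x + σO x : 𝒪[F]) : F) - ((0 : 𝒪[F]) : F))) * 2⁻¹ := by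
      rw [Subring.coe_add, hσO', Subring.coe_zero, sub_zero, show (-(k : ℤ) - e) = -(k : ℤ) + -(e : ℤ) by ring, zpow_add₀ h0]
      have : (ϖ : F) ^ (-(e : ℤ)) * ϖ ^ (e : ℤ) = 1 := by rw [← zpow_add₀ h0, neg_add_cancel, zpow_zero]
      calc ϖ ^ (-(k : ℤ)) * ϖ ^ (-(e : ℤ)) * (ϖ ^ (e : ℤ) * ((x : F) + σ x) * 2⁻¹)
          = ϖ ^ (-(k : ℤ)) * (ϖ ^ (-(e : ℤ)) * ϖ ^ (e : ℤ)) * ((x : F) + σ x) * 2⁻¹ := by ring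
        _ = _ := by rw [this, mul_one]
    rw [e1]
    -- `w · 2⁻¹ ∈ 𝒪 ↔ w ∈ 𝒪` (`|2| = 1`)
    have h2u : ∀ w : F, w * 2⁻¹ ∈ 𝒪[F] ↔ w ∈ 𝒪[F] := fun w => by
      rw [Valuation.mem_integer_iff, Valuation.mem_integer_iff, map_mul, map_inv₀, h2, inv_one, mul_one]
    rw [h2u, zpow_neg_mul_coe_sub_mem_iff_mk_eq_mk hϖ k, map_zero, map_add, ← eq_neg_iff_add_eq_zero]
    -- `σk (mk x) = mk (σO x)`
    have : (Ideal.quotientMap (maximalIdeal 𝒪[F] ^ k) σO (LocalFields.UnramifiedQuadraticNorm.maximalIdeal_pow_le_comap σO hσσ k)) (Ideal.Quotient.mk (maximalIdeal 𝒪[F] ^ k) x) = Ideal.Quotient.mk (maximalIdeal 𝒪[F] ^ k) (σO x) := Ideal.quotientMap_mk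
    rw [this]
    constructor
    · intro h; rw [h, neg_neg]
    · intro h; rw [h, neg_neg]
  -- lifts of residue classes
  have hlift : ∀ x : 𝒪[F] ⧸ (maximalIdeal 𝒪[F] ^ k), ∃ z : 𝒪[F], Ideal.Quotient.mk (maximalIdeal 𝒪[F] ^ k) z = x := fun x => Ideal.Quotient.mk_surjective x
  choose lift hlift using hlift
  -- `y(a) − y(b) = u⁻¹ (a − b) / 2`
  have hydiff : ∀ a b : F, yOf a - yOf b = u⁻¹ * (a - b) * 2⁻¹ := fun a b => by rw [hyOf]; ring
  have hcongr : ∀ a b : 𝒪[F], ϖ ^ (-(k : ℤ)) * (yOf a - yOf b) ∈ 𝒪[F] ↔ Ideal.Quotient.mk (maximalIdeal 𝒪[F] ^ k) a = Ideal.Quotient.mk (maximalIdeal 𝒪[F] ^ k) b := fun a b => by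
    rw [← zpow_neg_mul_coe_sub_mem_iff_mk_eq_mk hϖ k, hydiff]
    constructor
    · intro h
      have : ϖ ^ (-(k : ℤ)) * ((a : F) - b) = (ϖ ^ (-(k : ℤ)) * (u⁻¹ * ((a : F) - b) * 2⁻¹)) * (u * 2) := by field_simp
      rw [this]
      exact (𝒪[F]).mul_mem h ((𝒪[F]).mul_mem huO ((Valuation.mem_integer_iff _ _).2 h2.le))
    · intro h
      have : ϖ ^ (-(k : ℤ)) * (u⁻¹ * ((a : F) - b) * 2⁻¹) = (ϖ ^ (-(k : ℤ)) * ((a : F) - b)) * (u⁻¹ * 2⁻¹) := by ring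
      rw [this]
      exact (𝒪[F]).mul_mem h ((𝒪[F]).mul_mem huiO h2i)
  -- NEW for `e = 0`: `ϖ ∈ 𝒪`, the predicate in the `x`-coordinate, anti-fixedness of `ϖ x₁`
  have hϖO : ϖ ∈ 𝒪[F] := by simpa using (zpow_uniformizer_mem_integer_iff hϖ 1).2 (by norm_num)
  set xOf : 𝒪[F] → 𝒪[F] := fun z => ⟨ϖ, hϖO⟩ * z with hxOf
  have hxOfF : ∀ z : 𝒪[F], ((xOf z : 𝒪[F]) : F) = ϖ * z := fun z => rfl
  have hgxOf : ∀ s : F, ((Matrix.GeneralLinearGroup.mkOfDetNeZero _ (hdetT (yOf s)) : GL (Fin 2) F) : Matrix (Fin 2) (Fin 2) F) =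
      !![ϖ ^ (k : ℤ), yOf s; 0, ϖ ^ (-(k : ℤ) - e)] := fun s => Matrix.GeneralLinearGroup.val_mkOfDetNeZero _ _
  have hpow1 : (ϖ : F) ^ (-((k + 1 : ℕ) : ℤ)) = ϖ⁻¹ * ϖ ^ (-((k + e : ℕ) : ℤ)) := by
    rw [he0, ← _root_.zpow_neg_one, ← zpow_add₀ h0]; congr 1; push_cast; ring
  have hPiff : ∀ x : F, ϖ ^ (-((k + 1 : ℕ) : ℤ)) * (2 * (ϖ ^ (-(-(k : ℤ) - e)) * yOf x) + t) ∈ 𝒪[F] ↔ ϖ⁻¹ * x ∈ 𝒪[F] := fun x => by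
    rw [hpow1, mul_assoc, hF1 x]
    constructor
    · intro h
      have : ϖ⁻¹ * x = u * (ϖ⁻¹ * (u⁻¹ * x)) := by field_simp
      rw [this]; exact (𝒪[F]).mul_mem huO h
    · intro h
      have : ϖ⁻¹ * (u⁻¹ * x) = u⁻¹ * (ϖ⁻¹ * x) := by ring
      rw [this]; exact (𝒪[F]).mul_mem huiO h
  -- anti-fixedness mod `𝔪^j` in valuation form
  have hanti : ∀ (j : ℕ) (z : 𝒪[F]),
      (Ideal.quotientMap (maximalIdeal 𝒪[F] ^ j) σO (LocalFields.UnramifiedQuadraticNorm.maximalIdeal_pow_le_comap σO hσσ j)) (Ideal.Quotient.mk (maximalIdeal 𝒪[F] ^ j) z) =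
          -Ideal.Quotient.mk (maximalIdeal 𝒪[F] ^ j) z ↔
        ϖ ^ (-(j : ℤ)) * (σ z + z) ∈ 𝒪[F] := fun j z => by
    rw [Ideal.quotientMap_mk, ← map_neg, ← zpow_neg_mul_coe_sub_mem_iff_mk_eq_mk hϖ j, hσO', Subring.coe_neg, sub_neg_eq_add]
  have hkk : ((k - 1 : ℕ) : ℤ) = (k : ℤ) - 1 := by push_cast [Nat.cast_sub hk1]; ring
  have hshift : ∀ w : F, ϖ ^ (-(k : ℤ)) * (ϖ * w) = ϖ ^ (-((k - 1 : ℕ) : ℤ)) * w := fun w => by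
    rw [hkk, ← mul_assoc, ← zpow_add_one₀ h0]; congr 2; ring
  have hantiϖ : ∀ z : 𝒪[F],
      (Ideal.quotientMap (maximalIdeal 𝒪[F] ^ k) σO (LocalFields.UnramifiedQuadraticNorm.maximalIdeal_pow_le_comap σO hσσ k))
          (Ideal.Quotient.mk (maximalIdeal 𝒪[F] ^ k) (xOf z)) = -Ideal.Quotient.mk (maximalIdeal 𝒪[F] ^ k) (xOf z) ↔
      (Ideal.quotientMap (maximalIdeal 𝒪[F] ^ (k - 1)) σO (LocalFields.UnramifiedQuadraticNorm.maximalIdeal_pow_le_comap σO hσσ (k - 1)))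
          (Ideal.Quotient.mk (maximalIdeal 𝒪[F] ^ (k - 1)) z) = -Ideal.Quotient.mk (maximalIdeal 𝒪[F] ^ (k - 1)) z := fun z => by
    rw [hanti, hanti, hxOfF, map_mul, hσϖ, ← mul_add, hshift]
  have hcongrϖ : ∀ a b : 𝒪[F], Ideal.Quotient.mk (maximalIdeal 𝒪[F] ^ k) (xOf a) = Ideal.Quotient.mk (maximalIdeal 𝒪[F] ^ k) (xOf b) ↔
      Ideal.Quotient.mk (maximalIdeal 𝒪[F] ^ (k - 1)) a = Ideal.Quotient.mk (maximalIdeal 𝒪[F] ^ (k - 1)) b := fun a b => by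
    rw [← zpow_neg_mul_coe_sub_mem_iff_mk_eq_mk hϖ k, ← zpow_neg_mul_coe_sub_mem_iff_mk_eq_mk hϖ (k - 1), hxOfF, hxOfF, ← mul_sub, hshift]
  -- lifts of residue classes mod `𝔪^{k−1}`
  have hlift1 : ∀ x : 𝒪[F] ⧸ (maximalIdeal 𝒪[F] ^ (k - 1)), ∃ z : 𝒪[F], Ideal.Quotient.mk (maximalIdeal 𝒪[F] ^ (k - 1)) z = x := fun x =>
    Ideal.Quotient.mk_surjective x
  choose lift1 hlift1 using hlift1
  -- THE REFINED BIJECTION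
  change _ = Nat.card ({x : 𝒪[F] ⧸ (maximalIdeal 𝒪[F] ^ (k - 1)) | (Ideal.quotientMap (maximalIdeal 𝒪[F] ^ (k - 1)) σO (LocalFields.UnramifiedQuadraticNorm.maximalIdeal_pow_le_comap σO hσσ (k - 1))) x = -x} : Set (𝒪[F] ⧸ (maximalIdeal 𝒪[F] ^ (k - 1))))
  rw [Nat.card_coe_set_eq]
  symm
  refine Set.ncard_congr
    (fun x _ => Submodule.span 𝒪[F] (Set.range
      (!![ϖ ^ (k : ℤ), yOf (xOf (lift1 x)); 0, ϖ ^ (-(k : ℤ) - e)] : Matrix (Fin 2) (Fin 2) F)ᵀ)) ?_ ?_ ?_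
  · -- into the refined stratum
    intro x hx
    refine ⟨yOf (xOf (lift1 x)), _, hgxOf _, (hF3sd (xOf (lift1 x)) _ (hgxOf _)).2 ((hantiϖ _).2 (by rw [hlift1]; exact hx)),
      hF3st _ (xOf (lift1 x)).2 _ (hgxOf _), ?_, by rw [hgxOf]⟩
    rw [hPiff, hxOfF, inv_mul_cancel_left₀ h0]
    exact (lift1 x).2
  · -- injective
    intro x x' hx hx' hxx'
    obtain ⟨-, -, h3⟩ := (span_eq_span_iff_of_hermite hϖ _ _ (hgxOf (xOf (lift1 x))) (hgxOf (xOf (lift1 x')))).1 (by rw [hgxOf, hgxOf]; exact hxx')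
    rw [← hlift1 x, ← hlift1 x']
    exact ((hcongrϖ _ _).1 ((hcongr _ _).1 h3).symm)
  · -- surjective
    rintro Λ ⟨y, g, hg, hsd, hst, hpred, rfl⟩
    -- `z := ϖ^{-(k+e)}(2y′ + t) ∈ 𝒪`, `x := u z`, `y = yOf x`, and `x ∈ 𝔪` by the predicate
    obtain ⟨-, hyO, hnorm⟩ := (map_companion_span_eq_self_iff_of_hermite hϖ γ g hγ hd ht hg).1 hst
    rw [(companion_rescale_identities h0 (k := k) (e := e) rfl y t d β (σ β) (σ y)).1] at hnorm
    obtain ⟨-, hz⟩ := (norm_condition_iff hϖ h2 ht hD he hyO).1 hnorm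
    set z : F := ϖ ^ (-((k + e : ℕ) : ℤ)) * (2 * (ϖ ^ (-(-(k : ℤ) - e)) * y) + t) with hz'
    have hxO : u * z ∈ 𝒪[F] := (𝒪[F]).mul_mem huO hz
    have hyx : yOf (u * z) = y := by
      rw [hyOf, hz']
      have e1 : (ϖ : F) ^ (-(-(k : ℤ) - e)) = (ϖ ^ (-((k + e : ℕ) : ℤ)))⁻¹ := by rw [← _root_.zpow_neg]; congr 1; push_cast; ring
      rw [e1]; field_simp; ring
    have hx1O : ϖ⁻¹ * (u * z) ∈ 𝒪[F] := by
      have := hpred; rw [← hyx] at this; exact (hPiff _).1 this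
    have hxeq : xOf ⟨ϖ⁻¹ * (u * z), hx1O⟩ = ⟨u * z, hxO⟩ := Subtype.ext (by rw [hxOfF]; exact mul_inv_cancel_left₀ h0 _)
    refine ⟨Ideal.Quotient.mk (maximalIdeal 𝒪[F] ^ (k - 1)) ⟨_, hx1O⟩, ?_, ?_⟩
    · -- anti-fixed mod `𝔪^{k−1}`, from self-duality of `Λ` (anti-fixedness of `x = ϖ x₁` mod `𝔪^k`)
      have := (hF3sd ⟨_, hxO⟩ g (by rw [hg]; simp only [hyx])).1 hsd
      rw [← hxeq] at this
      exact (hantiϖ _).1 this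
    · -- the same lattice
      rw [← hgxOf (xOf (lift1 (Ideal.Quotient.mk (maximalIdeal 𝒪[F] ^ (k - 1)) ⟨_, hx1O⟩)))]
      refine span_eq_span_of_hermite_of_sub_mem hϖ _ g (hgxOf _) hg ?_
      rw [show y = yOf ((⟨u * z, hxO⟩ : 𝒪[F]) : F) from hyx.symm]
      refine (hcongr _ _).2 ?_
      rw [← hxeq, hcongrϖ, hlift1]

/-! ## §2 The interior count `Σ_{k<N} q^k` (both parities) -/

include hϖ hσO' hσσ hσϖ hσv h2 ht hd he hβ hD htr hγ in
/-- **THE INTERIOR VERTICES OF THE FIXED BALL NUMBER `Σ_{k<N} q^k`**: `#{Λ ∈ S(!![0, β; σβ, 0], C(t,d)) | (C − (t∕2)·1)·Λ ≤ ϖ·Λ} = Σ_{k=0}^{N−1} q^k` (`|𝓀| = q²`,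
`σ` moving an integer by a unit), for either parity `e ≤ 1` of `|β|`: by ★ `companion_scalarReduction_iff_of_hermite` the interior lattices of the stratum `k` are
all `q^k` of them when `e = 1, k < N`, none when `e = 1, k = N` or `e = 0, k = 0`, and the `q^{k−1}` of §1 when `e = 0, 1 ≤ k`.  With ★ (β2′-ii) this is Kottwitz's
edge count for a type-(2) element: `E = (q+1)·Σ_{k<N} q^k + q^N = 2·Σ_{k≤N} q^k − 1`. [cite: Flicker1998UnitaryFL, §6 p. 97] [cite: Serre1979, Ch. V §2] -/
theorem ncard_selfDualStable_scalarReduction_antidiag_companion_eq_sum {a₀ : 𝒪[F]} (ha₀ : IsUnit (σO a₀ - a₀)) {q : ℕ} [Finite (ResidueField 𝒪[F])]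
    (hq : Nat.card (ResidueField 𝒪[F]) = q ^ 2) :
    {Λ : Submodule 𝒪[F] (Fin 2 → F) |
        ((∃ g : GL (Fin 2) F, (∃ J' ∈ glInt 2 F, (J' : Matrix (Fin 2) (Fin 2) F) = formCongr σ g (!![0, β; σ β, 0] : Matrix (Fin 2) (Fin 2) F)) ∧
            Λ = Submodule.span 𝒪[F] (Set.range ((g : Matrix (Fin 2) (Fin 2) F))ᵀ)) ∧
          Λ.map ((Matrix.toLin' (γ : Matrix (Fin 2) (Fin 2) F)).restrictScalars 𝒪[F]) = Λ) ∧
        Λ.map ((Matrix.toLin' ((γ : Matrix (Fin 2) (Fin 2) F) - (t * 2⁻¹) • (1 : Matrix (Fin 2) (Fin 2) F))).restrictScalars 𝒪[F]) ≤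
          Λ.map ((Matrix.toLin' (ϖ • (1 : Matrix (Fin 2) (Fin 2) F))).restrictScalars 𝒪[F])}.ncard = ∑ k ∈ range N, q ^ k := by
  classical
  have h0 := hϖ.ne_zero
  have hσO : ∀ x : 𝒪[F], σ x ∈ 𝒪[F] := fun x => by rw [← hσO' x]; exact (σO x).2
  have hq1 : 1 ≤ q := by
    rcases Nat.eq_zero_or_pos q with rfl | h
    · rw [zero_pow two_ne_zero] at hq; exact absurd hq (Nat.card_pos (α := ResidueField 𝒪[F])).ne'
    · exact h
  -- the plain strata (★ (β2′-ii)) and the interior strata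
  set T : ℕ → Set (Submodule 𝒪[F] (Fin 2 → F)) := fun k =>
    {Λ | ∃ (y : F) (g : GL (Fin 2) F), (g : Matrix (Fin 2) (Fin 2) F) = !![ϖ ^ (k : ℤ), y; 0, ϖ ^ (-(k : ℤ) - e)] ∧
        (∃ J' ∈ glInt 2 F, (J' : Matrix (Fin 2) (Fin 2) F) = formCongr σ g (!![0, β; σ β, 0] : Matrix (Fin 2) (Fin 2) F)) ∧
        (Submodule.span 𝒪[F] (Set.range ((g : Matrix (Fin 2) (Fin 2) F))ᵀ)).map ((Matrix.toLin' (γ : Matrix (Fin 2) (Fin 2) F)).restrictScalars 𝒪[F]) =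
          Submodule.span 𝒪[F] (Set.range ((g : Matrix (Fin 2) (Fin 2) F))ᵀ) ∧
        Λ = Submodule.span 𝒪[F] (Set.range ((g : Matrix (Fin 2) (Fin 2) F))ᵀ)} with hT
  set T' : ℕ → Set (Submodule 𝒪[F] (Fin 2 → F)) := fun k =>
    {Λ | ∃ (y : F) (g : GL (Fin 2) F), (g : Matrix (Fin 2) (Fin 2) F) = !![ϖ ^ (k : ℤ), y; 0, ϖ ^ (-(k : ℤ) - e)] ∧
        (∃ J' ∈ glInt 2 F, (J' : Matrix (Fin 2) (Fin 2) F) = formCongr σ g (!![0, β; σ β, 0] : Matrix (Fin 2) (Fin 2) F)) ∧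
        (Submodule.span 𝒪[F] (Set.range ((g : Matrix (Fin 2) (Fin 2) F))ᵀ)).map ((Matrix.toLin' (γ : Matrix (Fin 2) (Fin 2) F)).restrictScalars 𝒪[F]) =
          Submodule.span 𝒪[F] (Set.range ((g : Matrix (Fin 2) (Fin 2) F))ᵀ) ∧
        (1 ≤ 2 * k + e ∧ k + e ≤ N ∧ ϖ ^ (-((k + 1 : ℕ) : ℤ)) * (2 * (ϖ ^ (-(-(k : ℤ) - e)) * y) + t) ∈ 𝒪[F]) ∧
        Λ = Submodule.span 𝒪[F] (Set.range ((g : Matrix (Fin 2) (Fin 2) F))ᵀ)} with hT'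
  have hsub : ∀ k, T' k ⊆ T k := fun k Λ => by
    rw [hT, hT']; rintro ⟨y, g, hg, hsd, hst, -, hΛ⟩; exact ⟨y, g, hg, hsd, hst, hΛ⟩
  have hvalT : ∀ k ∈ range (N + 1), (T k).ncard = q ^ k := fun k hk => by
    rw [hT]
    exact (ncard_stratum_antidiag_companion_eq_natCard_antifixed hϖ σ σO hσO' hσσ hσϖ hσv h2 ht hd he hβ hD htr γ hγ
      (Nat.lt_succ_iff.1 (Finset.mem_range.1 hk))).trans (LocalFields.UnramifiedQuadraticNorm.natCard_antifixed_quotient_pow σO hσσ ha₀ hq k)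
  have hfinT : ∀ k ∈ range (N + 1), (T k).Finite := fun k hk =>
    Set.finite_of_ncard_ne_zero (by rw [hvalT k hk]; exact pow_ne_zero _ (by omega))
  have hfin : ∀ k ∈ range (N + 1), (T' k).Finite := fun k hk => (hfinT k hk).subset (hsub k)
  -- the values of the interior strata
  have hval : ∀ k ∈ range (N + 1), (T' k).ncard = if 1 ≤ 2 * k + e ∧ k + e ≤ N then q ^ (k + e - 1) else 0 := fun k hk => by
    have hkN : k ≤ N := Nat.lt_succ_iff.1 (Finset.mem_range.1 hk)
    split_ifs with hc
    · rcases Nat.le_one_iff_eq_zero_or_eq_one.1 he with rfl | rfl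
      · -- `e = 0`, `1 ≤ k`: the refined stratum of §1
        have hk1 : 1 ≤ k := by omega
        rw [show k + 0 - 1 = k - 1 by omega,
          ← LocalFields.UnramifiedQuadraticNorm.natCard_antifixed_quotient_pow σO hσσ ha₀ hq (k - 1),
          ← ncard_stratum_scalarReduction_antidiag_companion_eq_natCard_antifixed hϖ σ σO hσO' hσσ hσϖ hσv h2 ht hd he hβ hD htr γ hγ rfl hk1 hkN, hT']
        congr 1
        ext Λ
        simp only [Set.mem_setOf_eq]
        constructor
        · rintro ⟨y, g, hg, hsd, hst, ⟨-, -, hp⟩, hΛ⟩; exact ⟨y, g, hg, hsd, hst, hp, hΛ⟩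
        · rintro ⟨y, g, hg, hsd, hst, hp, hΛ⟩; exact ⟨y, g, hg, hsd, hst, ⟨by omega, by omega, hp⟩, hΛ⟩
      · -- `e = 1`, `k < N`: the whole stratum (the third conjunct is automatic from stability)
        rw [show k + 1 - 1 = k by omega, ← hvalT k hk, hT, hT']
        congr 1
        ext Λ
        simp only [Set.mem_setOf_eq]
        constructor
        · rintro ⟨y, g, hg, hsd, hst, -, hΛ⟩; exact ⟨y, g, hg, hsd, hst, hΛ⟩
        · rintro ⟨y, g, hg, hsd, hst, hΛ⟩
          refine ⟨y, g, hg, hsd, hst, ⟨hc.1, hc.2, ?_⟩, hΛ⟩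
          obtain ⟨-, hyO, hnorm⟩ := (map_companion_span_eq_self_iff_of_hermite hϖ γ g hγ hd ht hg).1 hst
          rw [(companion_rescale_identities h0 (k := k) (e := 1) rfl y t d β (σ β) (σ y)).1] at hnorm
          exact ((norm_condition_iff hϖ h2 ht hD he hyO).1 hnorm).2
    · -- empty
      have hempty : T' k = ∅ := by
        rw [hT']
        ext Λ
        simp only [Set.mem_setOf_eq, Set.mem_empty_iff_false, iff_false]
        rintro ⟨y, g, hg, hsd, hst, ⟨h1, h3, -⟩, hΛ⟩
        exact hc ⟨h1, h3⟩
      rw [hempty, Set.ncard_empty]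
  -- the target set is the union of the interior strata
  set U : Finset (Submodule 𝒪[F] (Fin 2 → F)) := (range (N + 1)).attach.biUnion fun k => (hfin k.1 k.2).toFinset with hU
  have hSU : {Λ : Submodule 𝒪[F] (Fin 2 → F) |
        ((∃ g : GL (Fin 2) F, (∃ J' ∈ glInt 2 F, (J' : Matrix (Fin 2) (Fin 2) F) = formCongr σ g (!![0, β; σ β, 0] : Matrix (Fin 2) (Fin 2) F)) ∧
            Λ = Submodule.span 𝒪[F] (Set.range ((g : Matrix (Fin 2) (Fin 2) F))ᵀ)) ∧
          Λ.map ((Matrix.toLin' (γ : Matrix (Fin 2) (Fin 2) F)).restrictScalars 𝒪[F]) = Λ) ∧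
        Λ.map ((Matrix.toLin' ((γ : Matrix (Fin 2) (Fin 2) F) - (t * 2⁻¹) • (1 : Matrix (Fin 2) (Fin 2) F))).restrictScalars 𝒪[F]) ≤
          Λ.map ((Matrix.toLin' (ϖ • (1 : Matrix (Fin 2) (Fin 2) F))).restrictScalars 𝒪[F])} = (U : Set (Submodule 𝒪[F] (Fin 2 → F))) := by
    ext Λ
    have hS := mem_selfDualStable_antidiag_companion_iff hϖ σ hσϖ hσv hσO h2 ht hd he hβ hD γ hγ Λ
    rw [Set.mem_setOf_eq] at hS
    rw [Set.mem_setOf_eq, hS, hU, Finset.coe_biUnion]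
    simp only [Finset.mem_coe, Finset.mem_attach, Set.iUnion_true, Set.mem_iUnion, Set.Finite.coe_toFinset]
    constructor
    · rintro ⟨⟨k, hk, y, g, hg, hsd, hst, hΛ⟩, hsc⟩
      refine ⟨⟨k, Finset.mem_range.2 (Nat.lt_succ_of_le hk)⟩, ?_⟩
      rw [hT']
      rw [hΛ] at hsc
      exact ⟨y, g, hg, hsd, hst, (companion_scalarReduction_iff_of_hermite hϖ h2 ht hd he hD γ hγ g hg hst).1 hsc, hΛ⟩
    · rintro ⟨⟨k, hk⟩, hmem⟩
      rw [hT'] at hmem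
      obtain ⟨y, g, hg, hsd, hst, hsc, hΛ⟩ := hmem
      refine ⟨⟨k, Nat.lt_succ_iff.1 (Finset.mem_range.1 hk), y, g, hg, hsd, hst, hΛ⟩, ?_⟩
      rw [hΛ]
      exact (companion_scalarReduction_iff_of_hermite hϖ h2 ht hd he hD γ hγ g hg hst).2 hsc
  have hdisj : (↑(range (N + 1)).attach : Set {k // k ∈ range (N + 1)}).PairwiseDisjoint fun k => (hfin k.1 k.2).toFinset := by
    rintro ⟨k, hk⟩ - ⟨k', hk'⟩ - hne
    rw [Function.onFun, Set.Finite.disjoint_toFinset, Set.disjoint_left]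
    rintro Λ hΛ hΛ'
    rw [hT'] at hΛ hΛ'
    obtain ⟨y, g, hg, -, -, -, hΛg⟩ := hΛ
    obtain ⟨y', g', hg', -, -, -, hΛg'⟩ := hΛ'
    have h1 := ((span_eq_span_iff_of_hermite hϖ g g' hg hg').1 (hΛg.symm.trans hΛg')).1
    exact hne (Subtype.ext (by exact_mod_cast h1))
  rw [hSU, Set.ncard_coe_finset, hU, Finset.card_biUnion hdisj, ← Finset.sum_attach (range N)]
  -- the arithmetic `Σ_{k ≤ N} v(k) = Σ_{k < N} q^k`
  have hsum : ∑ k ∈ (range (N + 1)).attach, ((hfin k.1 k.2).toFinset).card = ∑ k ∈ range (N + 1), (if 1 ≤ 2 * k + e ∧ k + e ≤ N then q ^ (k + e - 1) else 0) := by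
    rw [← Finset.sum_attach (range (N + 1)) (fun k => if 1 ≤ 2 * k + e ∧ k + e ≤ N then q ^ (k + e - 1) else 0)]
    refine Finset.sum_congr rfl fun k _ => ?_
    rw [← Set.ncard_eq_toFinset_card _ (hfin k.1 k.2), hval k.1 k.2]
  rw [hsum, Finset.sum_attach (range N) (fun k => q ^ k)]
  rcases Nat.le_one_iff_eq_zero_or_eq_one.1 he with rfl | rfl
  · -- `e = 0`: shift `k ↦ k + 1`
    rw [Finset.sum_range_succ', if_neg (by omega), add_zero]
    refine Finset.sum_congr rfl fun k hk => ?_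
    rw [if_pos ⟨by omega, by have := Finset.mem_range.1 hk; omega⟩]
    congr 1
  · -- `e = 1`: drop the empty top stratum
    rw [Finset.sum_range_succ, if_neg (by omega), add_zero]
    refine Finset.sum_congr rfl fun k hk => ?_
    rw [if_pos ⟨by omega, by have := Finset.mem_range.1 hk; omega⟩, Nat.add_sub_cancel]

end Literature.NumberTheory.Automorphic

end
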